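import Mathlib
import Summits.NavierStokesRegularity.FluidComputer.TransportSobolevMultiplier
import Summits.NavierStokesRegularity.FluidComputer.TransportLinearisedLattice
import Summits.NavierStokesRegularity.FluidComputer.TransportGalerkinRapid
import HarnessLib

/-!
# The transport term on the lattice Sobolev scale, VI: the order-`σ` energy inequality of the perturbation field (instab g19, cell `ns-blowup`, 2026-08-27)

HONEST FRAMING (human ruling D-0035): nothing here is a claim about Navier–Stokes blow-up.
WHAT THIS IS NOT: not NS evidence — lattice (`ℤ^d`, Fourier-side) inequalities between real numbers
and `ℝ≥0∞` sums for RAPIDLY DECREASING coefficient families (every Galerkin level is finitely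
supported). No flow, set `W` or certificate is constructed.

PURPOSE. Residence (β3) of the R-β chain (`HOME/instab/BETA2-SPEC.md` §6) for `ν > 0` from the
bootstrap's own `H²` bound: along a Galerkin level `û(t)` of the perturbation equation about the host
`U` (coefficient field `linCoeff ν Uv π û + bilCoeff π û û` of `TransportGalerkinDefs`, Leray symbol
`P`), the `H^σ` energy `S_σ = ‖û‖_σ²` obeys

  `d/dt S_σ = 2 Re ⟨Λ^σ P(lin û + bil(û, û)), Λ^σ û⟩
           ≤ −2ν(2π)² (S_{σ+1} − S_σ) + 2(H₁ + H₂) S_σ + 2 K_σ A₁(û) S_σ`        (`two_re_pairing_field_le`)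

with HOST constants `H₁ = σ2^σ·2π·∑_j A_σ(U_j)` (advection by the host: smooth-multiplier commutator
of part V + skewness), `H₂ = 2^{σ/2}·card d·2π·A_{σ+1}(Uv)` (stretching: Peetre domination of part V),
the universal `K_σ = card d·σ2^σ·2π` in front of the ONE super-linear factor `A₁(û) = ∑_p ⟨p⟩‖û p‖`
(self-advection: rough × rough commutator of part IV + skewness `TransportSkewLattice`), and the exact
dissipation `Re⟨Λ^σ νΔû, Λ^σ û⟩ = −ν(2π)²(S_{σ+1} − S_σ)` (§1). The Leray symbol drops out against the
`P`-fixed family (`TransportSkewLattice.pairing_apply_eq_of_isSelfAdjoint`). Part VII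
(`TransportGalerkinResidence`) absorbs `A₁(û) ≤ σ₂ ‖û‖₃ ≤ σ₂ (‖û‖₂‖û‖₄)^{1/2}` into the dissipation
and runs Gronwall.

* §1 `re_pairing_wmul_laplacian_eq` — dissipation identity at order `s`;
* §2 `abs_re_pairing_wmul_natCast_transport_le` — advection by a smooth real divergence-free field,
  `|Re⟨Λ^σ T_y u, Λ^σ u⟩| ≤ σ2^σ·2π·(∑_j A_σ(y_j))·‖u‖_σ²` (part II's `σ = 2` statement at every order);
* §4 `abs_re_pairing_wmul_stretching_le` — stretching, `|Re⟨Λ^s T_{π∘u} Uv, Λ^s u⟩| ≤ 2^{s/2}·card d·2π·A_{s+1}(Uv)·‖u‖_s²`;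
* the companion file `TransportSobolevSelfAdvection.lean` carries §3 (self-advection, the one
  super-linear term) and §5 (the combination `two_re_pairing_field_le` displayed above).

References: classical `H^m` energy method for Navier–Stokes (e.g. Majda–Bertozzi 2002 §3.2,
Constantin–Foias 1988 Ch. 10) [folklore shape]; Kato–Ponce 1988 (commutator) [folklore shape].
-/

noncomputable section

open scoped ENNReal NNReal ComplexConjugate InnerProductSpace

namespace Summit.NavierStokesRegularity.FluidComputer.TransportSobolevEnergy

open Finset Complex
open Literature.Analysis.FunctionSpaces Literature.Analysis.FunctionSpaces.Lattice
open Literature.Analysis.FunctionSpaces.Torus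
open Summit.NavierStokesRegularity.FluidComputer.TransportCommutatorLattice
open Summit.NavierStokesRegularity.FluidComputer.TransportSkewLattice
open Summit.NavierStokesRegularity.FluidComputer.TransportLinearisedLattice
open Summit.NavierStokesRegularity.FluidComputer.TransportSobolevCommutator
open Summit.NavierStokesRegularity.FluidComputer.TransportSobolevMultiplier
open Summit.NavierStokesRegularity.FluidComputer.TransportGalerkin
open Summit.NavierStokesRegularity.FluidComputer.TransportGalerkinRapid

variable {d : Type*} [Fintype d]
variable {V : Type*} [NormedAddCommGroup V] [InnerProductSpace ℂ V] [CompleteSpace V]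

/-! ## §1 Dissipation is exact at every order -/

section Dissipation

omit [CompleteSpace V] in
/-- `∑_j ‖∂_j G‖₀² = (2π)² (‖G‖₁² − ‖G‖₀²)` as real numbers, for `G ∈ H¹`
(`Lattice.eNormSq_add_one` at `s = 0`). -/
theorem sum_toReal_eNormSq_freqDeriv_eq {G : (d → ℤ) → V} (hG : eNormSq 1 G < ∞) :
    ∑ j, (eNormSq 0 (freqDeriv j G)).toReal =
      (2 * Real.pi) ^ 2 * ((eNormSq 1 G).toReal - (eNormSq 0 G).toReal) := by
  have h := eNormSq_add_one 0 G
  rw [zero_add] at h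
  have hG0 : eNormSq 0 G < ∞ := (eNormSq_mono zero_le_one G).trans_lt hG
  have hπ : (0 : ℝ) < (2 * Real.pi) ^ 2 := by positivity
  have hD : ∀ j, eNormSq 0 (freqDeriv j G) < ∞ := fun j =>
    (eNormSq_freqDeriv_le 0 j G).trans_lt (ENNReal.mul_lt_top ENNReal.ofReal_lt_top (by rwa [zero_add]))
  have hsum : (∑ j, eNormSq 0 (freqDeriv j G)) < ∞ := ENNReal.sum_lt_top.2 fun j _ => hD j
  have h' := congrArg ENNReal.toReal h
  rw [ENNReal.toReal_add hG0.ne (ENNReal.mul_ne_top (ENNReal.inv_ne_top.2 (by positivity)) hsum.ne),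
    ENNReal.toReal_mul, ENNReal.toReal_inv, ENNReal.toReal_ofReal hπ.le,
    ENNReal.toReal_sum (fun j _ => (hD j).ne)] at h'
  field_simp at h'
  linarith

omit [CompleteSpace V] in
/-- **Dissipation identity at order `s`**: for `u ∈ H^{s+1}`,
`Re ⟨Λ^s (∑_j ∂_j∂_j u), Λ^s u⟩ = −(2π)² (‖u‖²_{s+1} − ‖u‖²_s)` — skew-adjointness of `∂_j`
(`Lattice.pairing_freqDeriv_left`), `Re⟨w, w⟩ = ‖w‖₀²` and §1's splitting. The exact form (not only
the sign of part III) is what lets the derivative loss of the self-advection be absorbed. -/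
theorem re_pairing_wmul_laplacian_eq (s : ℝ) {u : (d → ℤ) → V} (hu : eNormSq (s + 1) u < ∞) :
    (pairing (wmul s (∑ j, freqDeriv j (freqDeriv j u))) (wmul s u)).re =
      -((2 * Real.pi) ^ 2 * ((eNormSq (s + 1) u).toReal - (eNormSq s u).toReal)) := by
  set G := wmul s u with hG
  have hG1 : eNormSq 1 G < ∞ := by rw [hG, eNormSq_wmul, add_comm]; exact hu
  have hG0 : eNormSq 0 G < ∞ := (eNormSq_mono zero_le_one G).trans_lt hG1
  have hcomm : wmul s (∑ j, freqDeriv j (freqDeriv j u)) = ∑ j, freqDeriv j (freqDeriv j G) := by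
    rw [wmul_finset_sum]
    exact Finset.sum_congr rfl fun j _ => by rw [wmul_freqDeriv, wmul_freqDeriv]
  have hdG : ∀ j, eNormSq 0 (freqDeriv j G) < ∞ := fun j =>
    (eNormSq_freqDeriv_le 0 j _).trans_lt (ENNReal.mul_lt_top ENNReal.ofReal_lt_top (by rwa [zero_add]))
  have hs : ∀ j, Summable fun k => ⟪freqDeriv j (freqDeriv j G) k, G k⟫_ℂ := by
    intro j
    have h2 : eNormSq (-1) (freqDeriv j (freqDeriv j G)) < ∞ :=
      (eNormSq_freqDeriv_le (-1) j _).trans_lt (ENNReal.mul_lt_top ENNReal.ofReal_lt_top (by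
        norm_num; exact hdG j))
    exact summable_inner h2 (by rw [neg_neg]; exact hG1)
  rw [hcomm, pairing_finset_sum_left_of_summable _ fun j _ => hs j, Complex.re_sum]
  have hj : ∀ j, (pairing (freqDeriv j (freqDeriv j G)) G).re = -(eNormSq 0 (freqDeriv j G)).toReal := by
    intro j
    rw [pairing_freqDeriv_left j (freqDeriv j G) G, Complex.neg_re,
      ← toReal_eNormSq_zero_eq_re_pairing (hdG j)]
  simp only [hj, Finset.sum_neg_distrib, sum_toReal_eNormSq_freqDeriv_eq hG1]
  rw [hG, eNormSq_wmul, eNormSq_wmul, zero_add, add_comm]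

end Dissipation

/-! ## §2 Advection by a smooth real divergence-free field, every order -/

section HostTransport

/-- **The transport form at order `σ ≥ 1`** (advection BY a smooth field): for a rapidly decreasing,
real, divergence-free coefficient vector `y` and `u ∈ H^{σ+1}` (finiteness only), with
`T_y u = ∑_j y_j ⋆ ∂_j u`,

  `|Re ⟨Λ^σ T_y u, Λ^σ u⟩| ≤ σ2^σ · 2π · (∑_j A_σ(y_j)) · ‖u‖_σ²`,  `A_σ(y_j) = ∑_p ⟨p⟩^σ |y_j(p)|`

(`Λ^σ T_y u = T_y(Λ^σ u) + ∑_j [Λ^σ, y_j ⋆]∂_j u`; the first pairing is purely imaginary by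
`TransportSkewLattice.re_pairing_transport_eq_zero`, the commutators are bounded by part V's
`eNormSq_wmul_natCast_conv_sub_le_symb`). Part II's `abs_re_pairing_wmul_two_transport_le` is `σ = 2`
(with the sharper constant `6π`). -/
theorem abs_re_pairing_wmul_natCast_transport_le (y : d → (d → ℤ) → ℂ) (hy : ∀ j, RapidDecay (y j))
    (hreal : ∀ j p, y j (-p) = conj (y j p)) (hdiv : ∑ j, freqDeriv j (y j) = 0)
    {σ : ℕ} (hσ : 1 ≤ σ) {u : (d → ℤ) → V} (hu : eNormSq ((σ : ℝ) + 1) u < ∞) :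
    |(pairing (wmul (σ : ℝ) (∑ j, conv (scal (y j)) (freqDeriv j u))) (wmul (σ : ℝ) u)).re| ≤
      (σ * (2 : ℝ) ^ σ) * (2 * Real.pi) *
        (∑ j, (symbNorm (σ : ℝ) (scal (y j) : (d → ℤ) → (V →L[ℂ] V))).toReal) *
          (eNormSq (σ : ℝ) u).toReal := by
  have ha : ∀ j, RapidDecay (scal (y j) : (d → ℤ) → (V →L[ℂ] V)) := fun j => (hy j).scal
  set C : ℝ := σ * (2 : ℝ) ^ σ with hC
  have hC0 : 0 ≤ C := by positivity
  -- the advected family `G = Λ^σ u ∈ H¹`, and `u ∈ H^σ`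
  have hG1 : eNormSq 1 (wmul (σ : ℝ) u) < ∞ := by rw [eNormSq_wmul, add_comm]; exact hu
  have hG0 : eNormSq 0 (wmul (σ : ℝ) u) < ∞ := (eNormSq_mono zero_le_one _).trans_lt hG1
  have hG0' : eNormSq (-0) (wmul (σ : ℝ) u) < ∞ := by rw [neg_zero]; exact hG0
  have huσ : eNormSq (σ : ℝ) u < ∞ := (eNormSq_mono (by linarith) u).trans_lt hu
  have hut : Tempered u := ⟨_, hu⟩
  have hdu : ∀ j, eNormSq ((σ : ℝ) - 1) (freqDeriv j u) < ∞ := fun j =>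
    (eNormSq_freqDeriv_le _ j u).trans_lt (ENNReal.mul_lt_top ENNReal.ofReal_lt_top (by
      rw [sub_add_cancel]; exact huσ))
  have hdG0 : ∀ j, eNormSq 0 (freqDeriv j (wmul (σ : ℝ) u)) < ∞ := fun j =>
    (eNormSq_freqDeriv_le 0 j _).trans_lt (ENNReal.mul_lt_top ENNReal.ofReal_lt_top (by
      rwa [zero_add]))
  -- the commutators
  set R : d → (d → ℤ) → V := fun j =>
    wmul (σ : ℝ) (conv (scal (y j)) (freqDeriv j u)) - conv (scal (y j)) (wmul (σ : ℝ) (freqDeriv j u))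
    with hR
  have hRle : ∀ j, eNormSq 0 (R j) ≤ ENNReal.ofReal (C ^ 2) *
      symbNorm (σ : ℝ) (scal (y j) : (d → ℤ) → (V →L[ℂ] V)) ^ 2 * eNormSq ((σ : ℝ) - 1) (freqDeriv j u) :=
    fun j => eNormSq_wmul_natCast_conv_sub_le_symb (ha j) (hut.freqDeriv j) hσ
  have hRfin : ∀ j, eNormSq 0 (R j) < ∞ := fun j =>
    (hRle j).trans_lt (ENNReal.mul_lt_top (ENNReal.mul_lt_top ENNReal.ofReal_lt_top
      (ENNReal.pow_lt_top (symbNorm_lt_top_of_rapidDecay (ha j) _))) (hdu j))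
  -- decomposition `Λ^σ T = T(Λ^σ u) + ∑_j R_j`
  have hdec : wmul (σ : ℝ) (∑ j, conv (scal (y j)) (freqDeriv j u)) =
      (∑ j, conv (scal (y j)) (freqDeriv j (wmul (σ : ℝ) u))) + ∑ j, R j := by
    rw [wmul_finset_sum, ← Finset.sum_add_distrib]
    refine Finset.sum_congr rfl fun j _ => ?_
    rw [hR, ← wmul_freqDeriv]
    simp only
    abel
  have hsP : Summable fun k =>
      ⟪(∑ j, conv (scal (y j)) (freqDeriv j (wmul (σ : ℝ) u))) k, wmul (σ : ℝ) u k⟫_ℂ :=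
    summable_inner_finset_sum_left _ fun j _ =>
      summable_inner (eNormSq_conv_lt_top (ha j) (hdG0 j)) hG0'
  have hsR : ∀ j, Summable fun k => ⟪R j k, wmul (σ : ℝ) u k⟫_ℂ := fun j =>
    summable_inner (hRfin j) hG0'
  have hsplit : pairing (wmul (σ : ℝ) (∑ j, conv (scal (y j)) (freqDeriv j u))) (wmul (σ : ℝ) u) =
      pairing (∑ j, conv (scal (y j)) (freqDeriv j (wmul (σ : ℝ) u))) (wmul (σ : ℝ) u)
        + ∑ j, pairing (R j) (wmul (σ : ℝ) u) := by
    rw [hdec, pairing_add_left hsP (summable_inner_finset_sum_left _ fun j _ => hsR j),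
      pairing_finset_sum_left_of_summable _ fun j _ => hsR j]
  have hskew := re_pairing_transport_eq_zero y hy hreal hdiv hG1
  -- each commutator pairing
  have hnormG : (eNorm (-0) (wmul (σ : ℝ) u)).toReal = (eNorm (σ : ℝ) u).toReal := by
    rw [neg_zero, eNorm_wmul, zero_add]
  have hsqσ : (eNorm (σ : ℝ) u).toReal ^ 2 = (eNormSq (σ : ℝ) u).toReal := toReal_eNorm_sq _ _
  have hRj : ∀ j, ‖pairing (R j) (wmul (σ : ℝ) u)‖ ≤
      C * (2 * Real.pi) * (symbNorm (σ : ℝ) (scal (y j) : (d → ℤ) → (V →L[ℂ] V))).toReal *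
        (eNormSq (σ : ℝ) u).toReal := by
    intro j
    set A := symbNorm (σ : ℝ) (scal (y j) : (d → ℤ) → (V →L[ℂ] V)) with hA
    have hAfin : A ≠ ∞ := (symbNorm_lt_top_of_rapidDecay (ha j) _).ne
    have hduj : eNorm ((σ : ℝ) - 1) (freqDeriv j u) ≠ ∞ := (eNorm_lt_top_iff.2 (hdu j)).ne
    -- `‖R_j‖₀ ≤ C A ‖∂_j u‖_{σ-1}`
    have h1 : (eNorm 0 (R j)).toReal ≤ C * A.toReal * (eNorm ((σ : ℝ) - 1) (freqDeriv j u)).toReal := by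
      have hsq : eNorm 0 (R j) ≤ ENNReal.ofReal C * A * eNorm ((σ : ℝ) - 1) (freqDeriv j u) := by
        have h := hRle j
        calc eNorm 0 (R j) = (eNormSq 0 (R j)) ^ (1 / 2 : ℝ) := rfl
          _ ≤ (ENNReal.ofReal (C ^ 2) * A ^ 2 * eNormSq ((σ : ℝ) - 1) (freqDeriv j u)) ^ (1 / 2 : ℝ) := by
              gcongr
          _ = ENNReal.ofReal C * A * eNorm ((σ : ℝ) - 1) (freqDeriv j u) := by
              rw [ENNReal.ofReal_pow hC0, ← mul_pow, ENNReal.mul_rpow_of_nonneg _ _ (by norm_num),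
                ennreal_sq_rpow_half, eNorm]
      have hfin : ENNReal.ofReal C * A * eNorm ((σ : ℝ) - 1) (freqDeriv j u) ≠ ∞ :=
        ENNReal.mul_ne_top (ENNReal.mul_ne_top ENNReal.ofReal_ne_top hAfin) hduj
      have := ENNReal.toReal_mono hfin hsq
      rwa [ENNReal.toReal_mul, ENNReal.toReal_mul, ENNReal.toReal_ofReal hC0] at this
    -- `‖∂_j u‖_{σ-1} ≤ 2π ‖u‖_σ`
    have h2 : (eNorm ((σ : ℝ) - 1) (freqDeriv j u)).toReal ≤ 2 * Real.pi * (eNorm (σ : ℝ) u).toReal := by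
      have h := eNorm_freqDeriv_le ((σ : ℝ) - 1) j u
      rw [sub_add_cancel] at h
      have hfin : ENNReal.ofReal (2 * Real.pi) * eNorm (σ : ℝ) u ≠ ∞ :=
        ENNReal.mul_ne_top ENNReal.ofReal_ne_top (eNorm_lt_top_iff.2 huσ).ne
      have := ENNReal.toReal_mono hfin h
      rwa [ENNReal.toReal_mul, ENNReal.toReal_ofReal (by positivity)] at this
    have hA0 : 0 ≤ A.toReal := ENNReal.toReal_nonneg
    have hn0 : 0 ≤ (eNorm (σ : ℝ) u).toReal := ENNReal.toReal_nonneg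
    calc ‖pairing (R j) (wmul (σ : ℝ) u)‖
        ≤ (eNorm 0 (R j)).toReal * (eNorm (-0) (wmul (σ : ℝ) u)).toReal := norm_pairing_le (hRfin j) hG0'
      _ ≤ (C * A.toReal * (2 * Real.pi * (eNorm (σ : ℝ) u).toReal)) * (eNorm (σ : ℝ) u).toReal := by
          rw [hnormG]
          exact mul_le_mul_of_nonneg_right
            (h1.trans (mul_le_mul_of_nonneg_left h2 (by positivity))) hn0
      _ = C * (2 * Real.pi) * A.toReal * (eNorm (σ : ℝ) u).toReal ^ 2 := by ring
      _ = _ := by rw [hsqσ]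
  -- assemble
  rw [hsplit, Complex.add_re, hskew, zero_add, Complex.re_sum]
  calc |∑ j, (pairing (R j) (wmul (σ : ℝ) u)).re| ≤ ∑ j, |(pairing (R j) (wmul (σ : ℝ) u)).re| :=
        Finset.abs_sum_le_sum_abs _ _
    _ ≤ ∑ j, C * (2 * Real.pi) * (symbNorm (σ : ℝ) (scal (y j) : (d → ℤ) → (V →L[ℂ] V))).toReal *
          (eNormSq (σ : ℝ) u).toReal :=
        Finset.sum_le_sum fun j _ => (Complex.abs_re_le_norm _).trans (hRj j)
    _ = _ := by rw [Finset.mul_sum, Finset.sum_mul]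

end HostTransport

/-! ## §4 Stretching, every order -/

section Stretching

omit [CompleteSpace V] in
/-- **Stretching at order `s ≥ 0`**: for `u ∈ H^s`, a host coefficient family `Uv` with
`A_{s+1}(Uv) = ∑_l ⟨l⟩^{s+1} ‖Uv l‖ < ∞`, coordinate functionals of norm `≤ 1`, and
`T_{π∘u} Uv = ∑_j (π_j ∘ u) ⋆ ∂_j Uv` the coefficients of `(u·∇)U`,

  `|Re ⟨Λ^s T_{π∘u} Uv, Λ^s u⟩| ≤ 2^{s/2} · card d · 2π · A_{s+1}(Uv) · ‖u‖_s²`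

(domination `TransportCommutatorLattice.enorm_transport_apply_le` + part V's
`eNormSq_le_of_transport_domination` + Cauchy–Schwarz `Lattice.norm_pairing_le`). Part III's
`abs_re_pairing_wmul_two_stretching_le` is `s = 2`. -/
theorem abs_re_pairing_wmul_stretching_le {s : ℝ} (hs : 0 ≤ s) (π : d → (V →L[ℂ] ℂ))
    (hπ : ∀ j, ‖π j‖ ≤ 1) (Uv : (d → ℤ) → V)
    (hUv : ∑' l, ENNReal.ofReal (sobolevWeight (s + 1) l) * ‖Uv l‖ₑ < ∞)
    {u : (d → ℤ) → V} (hu : eNormSq s u < ∞) :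
    |(pairing (wmul s (∑ j, conv (scal (fun p => π j (u p))) (freqDeriv j Uv))) (wmul s u)).re| ≤
      (2 : ℝ) ^ (s / 2) * ((Fintype.card d : ℝ) * (2 * Real.pi)) *
        (∑' l, ENNReal.ofReal (sobolevWeight (s + 1) l) * ‖Uv l‖ₑ).toReal * (eNormSq s u).toReal := by
  set T := ∑ j, conv (scal (fun p => π j (u p)) : (d → ℤ) → (V →L[ℂ] V)) (freqDeriv j Uv) with hT
  set A := ∑' l, ENNReal.ofReal (sobolevWeight (s + 1) l) * ‖Uv l‖ₑ with hA
  set Cd : ℝ≥0∞ := (Fintype.card d : ℝ≥0∞) * ENNReal.ofReal (2 * Real.pi) with hCd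
  have hsq : eNormSq s T ≤ ENNReal.ofReal ((2 : ℝ) ^ s) * Cd ^ 2 * A ^ 2 * eNormSq s u :=
    eNormSq_le_of_transport_domination hs u Uv Cd fun k =>
      enorm_transport_apply_le (fun j p => π j (u p)) u (fun j p => norm_comp_le π hπ u j p) Uv k
  have hD : (2 : ℝ) ^ s = ((2 : ℝ) ^ (s / 2)) ^ 2 := by
    rw [← Real.rpow_natCast, ← Real.rpow_mul (by norm_num)]; norm_num
  have hTs : eNorm s T ≤ ENNReal.ofReal ((2 : ℝ) ^ (s / 2)) * Cd * A * eNorm s u := by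
    calc eNorm s T = (eNormSq s T) ^ (1 / 2 : ℝ) := rfl
      _ ≤ (ENNReal.ofReal ((2 : ℝ) ^ s) * Cd ^ 2 * A ^ 2 * eNormSq s u) ^ (1 / 2 : ℝ) := by gcongr
      _ = ENNReal.ofReal ((2 : ℝ) ^ (s / 2)) * Cd * A * eNorm s u := by
          rw [hD, ENNReal.ofReal_pow (by positivity), ← mul_pow, ← mul_pow,
            ENNReal.mul_rpow_of_nonneg _ _ (by norm_num), ennreal_sq_rpow_half, eNorm]
  have hTfin : eNormSq s T < ∞ :=
    hsq.trans_lt (ENNReal.mul_lt_top (ENNReal.mul_lt_top (ENNReal.mul_lt_top ENNReal.ofReal_lt_top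
      (ENNReal.pow_lt_top (ENNReal.mul_lt_top (ENNReal.natCast_lt_top _) ENNReal.ofReal_lt_top)))
        (ENNReal.pow_lt_top hUv)) hu)
  have hT0 : eNormSq 0 (wmul s T) < ∞ := by rw [eNormSq_wmul, zero_add]; exact hTfin
  have hu0 : eNormSq (-0) (wmul s u) < ∞ := by rw [neg_zero, eNormSq_wmul, zero_add]; exact hu
  have hCd_toReal : Cd.toReal = (Fintype.card d : ℝ) * (2 * Real.pi) := by
    rw [hCd, ENNReal.toReal_mul, ENNReal.toReal_natCast, ENNReal.toReal_ofReal (by positivity)]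
  have hfin : ENNReal.ofReal ((2 : ℝ) ^ (s / 2)) * Cd * A * eNorm s u ≠ ∞ :=
    ENNReal.mul_ne_top (ENNReal.mul_ne_top (ENNReal.mul_ne_top ENNReal.ofReal_ne_top
      (ENNReal.mul_ne_top (ENNReal.natCast_ne_top _) ENNReal.ofReal_ne_top)) hUv.ne)
      (eNorm_lt_top_iff.2 hu).ne
  have h1 : (eNorm 0 (wmul s T)).toReal ≤
      (2 : ℝ) ^ (s / 2) * ((Fintype.card d : ℝ) * (2 * Real.pi)) * A.toReal * (eNorm s u).toReal := by
    have hTs' : eNorm 0 (wmul s T) ≤ ENNReal.ofReal ((2 : ℝ) ^ (s / 2)) * Cd * A * eNorm s u := by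
      rw [eNorm_wmul, zero_add]; exact hTs
    have := ENNReal.toReal_mono hfin hTs'
    rwa [ENNReal.toReal_mul, ENNReal.toReal_mul, ENNReal.toReal_mul,
      ENNReal.toReal_ofReal (by positivity), hCd_toReal] at this
  have h2 : (eNorm (-0) (wmul s u)).toReal = (eNorm s u).toReal := by
    rw [neg_zero, eNorm_wmul, zero_add]
  calc |(pairing (wmul s T) (wmul s u)).re| ≤ ‖pairing (wmul s T) (wmul s u)‖ := Complex.abs_re_le_norm _
    _ ≤ (eNorm 0 (wmul s T)).toReal * (eNorm (-0) (wmul s u)).toReal := norm_pairing_le hT0 hu0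
    _ ≤ ((2 : ℝ) ^ (s / 2) * ((Fintype.card d : ℝ) * (2 * Real.pi)) * A.toReal * (eNorm s u).toReal) *
          (eNorm s u).toReal := by
        rw [h2]; exact mul_le_mul_of_nonneg_right h1 ENNReal.toReal_nonneg
    _ = _ := by rw [mul_assoc, ← sq, toReal_eNorm_sq]

end Stretching
end Summit.NavierStokesRegularity.FluidComputer.TransportSobolevEnergy

end
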